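import Summits.CriticalPhenomena.PercolationContinuityZ3.Theorems.PercAnnulusCrossingIICKernelFactorisation
import HarnessLib

/-!
# Kesten–Basu–Sapozhnikov IIC scheme in boxes, X: the kernel as an exact sum over the inward data (lane RSW3, p1 gen 3)

builds on p205010 (kernel theorem, internal audit signed; external expert review pending)

Seat `prim-rsw3-p1` (gen 3); LANE-4 blueprint, memo `run/shared/lean/prim/rsw3/P1-QM.md` §13.4 step (3).  Helper file; no definitions, no
sorries; every `p`, `d`.  Notation of parts IV, VIII, IX.  With the inward data `I = (Xs,Ys)` of the shell `(c,s)` ranging over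
`𝒟_in = {Xs ⊆ Λ(s−1) ∖ Λ(c)} × {Ys ⊆ ∂ⁱⁿΛ(c)}` and `GOOD_in = ⋃_I IDAT(I) ∩ ILINK(I)`:
* `crossRatio_le_of_sandwich` — algebra: a kernel `Σ_I f(I) g(I)` with `ϰ·a·b(I) ≤ f(I) ≤ a·b(I)` has cross-ratios `≤ ϰ⁻²`;
* **`sum_real_kernel_eq`** — `Σ_I P(FIRST(H,X;I)) · P(IDAT ∩ ILINK ∩ SECOND(U,R;I) ∩ DAT ∩ LINK') = P(GOOD_in ∩ LEFT(H,X;U,R) ∩ DAT(U,R) ∩ LINK'(U,R))`,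
  the KERNEL `M((H,X);(U,R))` of Kesten's scheme (exact; the inward data events are pairwise disjoint).
References: D. Basu, A. Sapozhnikov, ECP 22 (2017) no. 26, §2 (before (2.8)); H. Kesten, PTRF 73 (1986) §2 Lemma (23).
-/

noncomputable section

namespace Summit.CriticalPhenomena.PercolationContinuityZ3.Theorems.Crossing

open MeasureTheory Literature.Probability.Percolation Literature.Probability.LatticeModels
open Literature.Probability.Percolation.DCT16
open Summit.CriticalPhenomena.PercolationContinuityZ3.Theorems.SurfaceTension
open scoped Literature.Probability.Percolation

variable {d : ℕ}

/-! ## Algebra: a kernel sandwiched by a rank-one kernel has bounded cross-ratios -/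

/-- If `ϰ·a·b i ≤ f i ≤ a·b i` and `ϰ·a'·b i ≤ f' i ≤ a'·b i` with `g, g', b ≥ 0`, `ϰ, a, a' ≥ 0`, then
`(Σ f g)(Σ f' g') · ϰ² ≤ (Σ f g')(Σ f' g)`. [cite: Kesten1986, §2 Lemma (23)] -/
theorem crossRatio_le_of_sandwich {ι : Type*} (s : Finset ι) {ϰ a a' : ℝ} (hϰ : 0 ≤ ϰ) (ha : 0 ≤ a) (ha' : 0 ≤ a')
    {f f' g g' b : ι → ℝ} (hg : ∀ i ∈ s, 0 ≤ g i) (hg' : ∀ i ∈ s, 0 ≤ g' i) (hb : ∀ i ∈ s, 0 ≤ b i)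
    (hf : ∀ i ∈ s, ϰ * a * b i ≤ f i ∧ f i ≤ a * b i) (hf' : ∀ i ∈ s, ϰ * a' * b i ≤ f' i ∧ f' i ≤ a' * b i) :
    ϰ ^ 2 * ((∑ i ∈ s, f i * g i) * (∑ i ∈ s, f' i * g' i)) ≤ (∑ i ∈ s, f i * g' i) * (∑ i ∈ s, f' i * g i) := by
  have h1 : ∑ i ∈ s, f i * g i ≤ a * ∑ i ∈ s, b i * g i := by
    rw [Finset.mul_sum]
    exact Finset.sum_le_sum fun i hi => by
      calc f i * g i ≤ a * b i * g i := mul_le_mul_of_nonneg_right (hf i hi).2 (hg i hi)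
        _ = a * (b i * g i) := by ring
  have h2 : ∑ i ∈ s, f' i * g' i ≤ a' * ∑ i ∈ s, b i * g' i := by
    rw [Finset.mul_sum]
    exact Finset.sum_le_sum fun i hi => by
      calc f' i * g' i ≤ a' * b i * g' i := mul_le_mul_of_nonneg_right (hf' i hi).2 (hg' i hi)
        _ = a' * (b i * g' i) := by ring
  have h3 : ϰ * a * ∑ i ∈ s, b i * g' i ≤ ∑ i ∈ s, f i * g' i := by
    rw [Finset.mul_sum]
    exact Finset.sum_le_sum fun i hi => by
      calc ϰ * a * (b i * g' i) = ϰ * a * b i * g' i := by ring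
        _ ≤ f i * g' i := mul_le_mul_of_nonneg_right (hf i hi).1 (hg' i hi)
  have h4 : ϰ * a' * ∑ i ∈ s, b i * g i ≤ ∑ i ∈ s, f' i * g i := by
    rw [Finset.mul_sum]
    exact Finset.sum_le_sum fun i hi => by
      calc ϰ * a' * (b i * g i) = ϰ * a' * b i * g i := by ring
        _ ≤ f' i * g i := mul_le_mul_of_nonneg_right (hf' i hi).1 (hg i hi)
  have hB : 0 ≤ ∑ i ∈ s, b i * g i := Finset.sum_nonneg fun i hi => mul_nonneg (hb i hi) (hg i hi)
  have hB' : 0 ≤ ∑ i ∈ s, b i * g' i := Finset.sum_nonneg fun i hi => mul_nonneg (hb i hi) (hg' i hi)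
  have hF : 0 ≤ ∑ i ∈ s, f i * g i := Finset.sum_nonneg fun i hi =>
    mul_nonneg ((mul_nonneg (mul_nonneg hϰ ha) (hb i hi)).trans (hf i hi).1) (hg i hi)
  have hF' : 0 ≤ ∑ i ∈ s, f' i * g' i := Finset.sum_nonneg fun i hi =>
    mul_nonneg ((mul_nonneg (mul_nonneg hϰ ha') (hb i hi)).trans (hf' i hi).1) (hg' i hi)
  calc ϰ ^ 2 * ((∑ i ∈ s, f i * g i) * (∑ i ∈ s, f' i * g' i))
      ≤ ϰ ^ 2 * ((a * ∑ i ∈ s, b i * g i) * (a' * ∑ i ∈ s, b i * g' i)) :=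
        mul_le_mul_of_nonneg_left (mul_le_mul h1 h2 hF' (mul_nonneg ha hB)) (sq_nonneg ϰ)
    _ = (ϰ * a * ∑ i ∈ s, b i * g' i) * (ϰ * a' * ∑ i ∈ s, b i * g i) := by ring
    _ ≤ (∑ i ∈ s, f i * g' i) * (∑ i ∈ s, f' i * g i) :=
        mul_le_mul h3 h4 (mul_nonneg (mul_nonneg hϰ ha') hB) ((mul_nonneg (mul_nonneg hϰ ha) hB').trans h3)

/-! ## The kernel as an exact sum over the inward data -/

/-- **The kernel of Kesten's scheme, summed over the inward data** (exact): see the module docstring.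
[cite: BasuSapozhnikov2017ECP, §2 (display before (2.8))] -/
theorem sum_real_kernel_eq (p : unitInterval) {c s a b : ℕ} (hc : 1 ≤ c) (hcs : c + 2 ≤ s) (hsa : s ≤ a) (hab : a ≤ b)
    {H X U R : Finset (Site d)} (hH : H ⊆ box d (c - 1)) (hX : X ⊆ box d (c - 1))
    (hUa : box d a ⊆ U) (hUb : U ⊆ box d b) (hR : R ⊆ box d (b + 1)) (hRb : ∀ r ∈ R, r ∉ box d b) :
    ∑ I ∈ (box d (s - 1) \ box d c).powerset ×ˢ (innerBoundary (zdGraph d) (box d c)).powerset,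
        (bondPercolation (zdGraph d) p).real {ω : BondConfig (Site d) | ∃ x ∈ X, ∃ y ∈ I.2,
            ω ∈ openConnIn ((↑(box d s) : Set (Site d)) \ (↑(I.1 ∪ innerBoundary (zdGraph d) (box d s)) ∪ ↑H)) x y} *
        (bondPercolation (zdGraph d) p).real
          ({ω : BondConfig (Site d) | ω ∩ (↑((box d s).sym2) : Set (Sym2 (Site d))) ∈
              explEvent ((↑(box d (s - 1)) : Set (Site d))ᶜ) ((↑(box d (s - 1)) : Set (Site d)) \ ↑(box d c))
                ((↑(box d (s - 1)) : Set (Site d))ᶜ ∪ ↑I.1) ↑I.2} ∩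
           {ω : BondConfig (Site d) | ∀ y ∈ I.2, ∀ y' ∈ I.2, ∀ z ∈ I.1 ∪ innerBoundary (zdGraph d) (box d s),
              ∀ z' ∈ I.1 ∪ innerBoundary (zdGraph d) (box d s), s(z, y) ∈ ω → s(z', y') ∈ ω →
              ω ∈ openConnIn (↑(I.1 ∪ innerBoundary (zdGraph d) (box d s)) : Set (Site d)) z z'} ∩
           {ω : BondConfig (Site d) | ∃ y ∈ I.2, ∃ z ∈ I.1 ∪ innerBoundary (zdGraph d) (box d s), s(z, y) ∈ ω ∧
              ∃ r ∈ R, ∃ v ∈ U,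
                ω ∈ openConnIn ((↑(I.1 ∪ innerBoundary (zdGraph d) (box d s)) : Set (Site d)) ∪ (↑U \ ↑(box d s))) z v ∧ s(v, r) ∈ ω} ∩
           {ω : BondConfig (Site d) | ω ∩ (↑((box d (b + 1)).sym2) : Set (Sym2 (Site d))) ∈
              explEvent (↑(box d a) : Set (Site d)) ((↑(box d b) : Set (Site d)) \ ↑(box d a)) ↑U ↑R} ∩
           {ω : BondConfig (Site d) | ∀ r ∈ R, ∀ r' ∈ R, ∃ v ∈ U, ∃ v' ∈ U,
              s(v, r) ∈ ω ∧ s(v', r') ∈ ω ∧ ω ∈ openConnIn ((↑U : Set (Site d)) \ ↑(box d (a - 1))) v v'}) =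
      (bondPercolation (zdGraph d) p).real
        ((⋃ I ∈ (box d (s - 1) \ box d c).powerset ×ˢ (innerBoundary (zdGraph d) (box d c)).powerset,
            ({ω : BondConfig (Site d) | ω ∩ (↑((box d s).sym2) : Set (Sym2 (Site d))) ∈
                explEvent ((↑(box d (s - 1)) : Set (Site d))ᶜ) ((↑(box d (s - 1)) : Set (Site d)) \ ↑(box d c))
                  ((↑(box d (s - 1)) : Set (Site d))ᶜ ∪ ↑I.1) ↑I.2} ∩
             {ω : BondConfig (Site d) | ∀ y ∈ I.2, ∀ y' ∈ I.2, ∀ z ∈ I.1 ∪ innerBoundary (zdGraph d) (box d s),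
                ∀ z' ∈ I.1 ∪ innerBoundary (zdGraph d) (box d s), s(z, y) ∈ ω → s(z', y') ∈ ω →
                ω ∈ openConnIn (↑(I.1 ∪ innerBoundary (zdGraph d) (box d s)) : Set (Site d)) z z'})) ∩
          ({ω : BondConfig (Site d) | ∃ x ∈ X, ∃ r ∈ R, ∃ v ∈ U, ω ∈ openConnIn ((↑U : Set (Site d)) \ ↑H) x v ∧ s(v, r) ∈ ω} ∩
           {ω : BondConfig (Site d) | ω ∩ (↑((box d (b + 1)).sym2) : Set (Sym2 (Site d))) ∈
              explEvent (↑(box d a) : Set (Site d)) ((↑(box d b) : Set (Site d)) \ ↑(box d a)) ↑U ↑R} ∩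
           {ω : BondConfig (Site d) | ∀ r ∈ R, ∀ r' ∈ R, ∃ v ∈ U, ∃ v' ∈ U,
              s(v, r) ∈ ω ∧ s(v', r') ∈ ω ∧ ω ∈ openConnIn ((↑U : Set (Site d)) \ ↑(box d (a - 1))) v v'})) := by
  classical
  set μ := bondPercolation (zdGraph d) p with hμ
  set 𝒟 := (box d (s - 1) \ box d c).powerset ×ˢ (innerBoundary (zdGraph d) (box d c)).powerset with h𝒟
  set In' : Set (Site d) := (↑(box d (s - 1)) : Set (Site d))ᶜ with hIn'
  set Blk' : Set (Site d) := (↑(box d (s - 1)) : Set (Site d)) \ ↑(box d c) with hBlk'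
  set IDAT : Finset (Site d) × Finset (Site d) → Set (BondConfig (Site d)) := fun I =>
    {ω | ω ∩ (↑((box d s).sym2) : Set (Sym2 (Site d))) ∈ explEvent In' Blk' (In' ∪ ↑I.1) ↑I.2} with hIDAT
  set ILINK : Finset (Site d) × Finset (Site d) → Set (BondConfig (Site d)) := fun I =>
    {ω | ∀ y ∈ I.2, ∀ y' ∈ I.2, ∀ z ∈ I.1 ∪ innerBoundary (zdGraph d) (box d s),
      ∀ z' ∈ I.1 ∪ innerBoundary (zdGraph d) (box d s), s(z, y) ∈ ω → s(z', y') ∈ ω →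
      ω ∈ openConnIn (↑(I.1 ∪ innerBoundary (zdGraph d) (box d s)) : Set (Site d)) z z'} with hILINK
  set FIRST : Finset (Site d) × Finset (Site d) → Set (BondConfig (Site d)) := fun I =>
    {ω | ∃ x ∈ X, ∃ y ∈ I.2, ω ∈ openConnIn ((↑(box d s) : Set (Site d)) \ (↑(I.1 ∪ innerBoundary (zdGraph d) (box d s)) ∪ ↑H)) x y}
    with hFIRST
  set SECOND : Finset (Site d) × Finset (Site d) → Set (BondConfig (Site d)) := fun I =>
    {ω | ∃ y ∈ I.2, ∃ z ∈ I.1 ∪ innerBoundary (zdGraph d) (box d s), s(z, y) ∈ ω ∧ ∃ r ∈ R, ∃ v ∈ U,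
      ω ∈ openConnIn ((↑(I.1 ∪ innerBoundary (zdGraph d) (box d s)) : Set (Site d)) ∪ (↑U \ ↑(box d s))) z v ∧ s(v, r) ∈ ω}
    with hSECOND
  set LEFT := {ω : BondConfig (Site d) | ∃ x ∈ X, ∃ r ∈ R, ∃ v ∈ U, ω ∈ openConnIn ((↑U : Set (Site d)) \ ↑H) x v ∧ s(v, r) ∈ ω}
    with hLEFT
  set DAT := {ω : BondConfig (Site d) | ω ∩ (↑((box d (b + 1)).sym2) : Set (Sym2 (Site d))) ∈
    explEvent (↑(box d a) : Set (Site d)) ((↑(box d b) : Set (Site d)) \ ↑(box d a)) ↑U ↑R} with hDAT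
  set LINK := {ω : BondConfig (Site d) | ∀ r ∈ R, ∀ r' ∈ R, ∃ v ∈ U, ∃ v' ∈ U,
    s(v, r) ∈ ω ∧ s(v', r') ∈ ω ∧ ω ∈ openConnIn ((↑U : Set (Site d)) \ ↑(box d (a - 1))) v v'} with hLINK
  have hmem𝒟 : ∀ I ∈ 𝒟, I.1 ⊆ box d (s - 1) \ box d c ∧ I.2 ⊆ innerBoundary (zdGraph d) (box d c) := by
    intro I hI
    rw [h𝒟, Finset.mem_product, Finset.mem_powerset, Finset.mem_powerset] at hI
    exact hI
  -- finite determining sets, measurability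
  have hTfin : ∀ I : Finset (Site d) × Finset (Site d),
      {e : Sym2 (Site d) | e ∈ (↑((box d s).sym2) : Set (Sym2 (Site d))) ∧
        ∃ v ∈ (↑(I.1 ∪ innerBoundary (zdGraph d) (box d s)) : Set (Site d)), v ∈ e} ⊆
        ↑(((box d s).sym2).filter (fun e => ∃ v ∈ I.1 ∪ innerBoundary (zdGraph d) (box d s), v ∈ e)) := by
    rintro I e ⟨he, v, hv, hve⟩
    rw [Finset.coe_filter]
    exact ⟨Finset.mem_coe.1 he, v, Finset.mem_coe.1 hv, hve⟩
  have hTU : {e : Sym2 (Site d) | e ∈ (↑((box d (b + 1)).sym2) : Set (Sym2 (Site d))) ∧ ∃ u ∈ (↑U : Set (Site d)), u ∈ e} ⊆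
      ↑(((box d (b + 1)).sym2).filter (fun e => ∃ u ∈ U, u ∈ e)) := by
    rintro e ⟨he, u, hu, hue⟩
    rw [Finset.coe_filter]
    exact ⟨Finset.mem_coe.1 he, u, Finset.mem_coe.1 hu, hue⟩
  have hKmeas : MeasurableSet (LEFT ∩ DAT ∩ LINK) :=
    ((((determinedBy_leftHX (H := H) (X := X) hUb hR).mono hTU).measurableSet_of_finset).inter
      (((determinedBy_dat a b U R).mono hTU).measurableSet_of_finset)).inter
      (((determinedBy_link' (a := a) hUb hR).mono hTU).measurableSet_of_finset)
  have hpiece_meas : ∀ I ∈ 𝒟, MeasurableSet (IDAT I ∩ ILINK I ∩ (LEFT ∩ DAT ∩ LINK)) := by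
    intro I hI
    obtain ⟨hXs, hYs⟩ := hmem𝒟 I hI
    exact ((((determinedBy_idat (c := c) (by omega : 1 ≤ s) I.1 I.2).mono (hTfin I)).measurableSet_of_finset).inter
      (((determinedBy_ilink (by omega : c ≤ s) hXs hYs).mono (hTfin I)).measurableSet_of_finset)).inter hKmeas
  -- the inward data events are pairwise disjoint
  have hdisj : Set.PairwiseDisjoint (↑𝒟 : Set (Finset (Site d) × Finset (Site d)))
      (fun I => IDAT I ∩ ILINK I ∩ (LEFT ∩ DAT ∩ LINK)) := by
    intro I hI I' hI' hne
    refine Set.disjoint_left.2 fun ω h1 h2 => hne ?_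
    have hsub : ∀ J ∈ (↑𝒟 : Set (Finset (Site d) × Finset (Site d))), ∀ x ∈ J.1, x ∉ In' := by
      intro J hJ x hx hxIn
      exact hxIn (Finset.mem_coe.2 (Finset.mem_sdiff.1 ((hmem𝒟 J hJ).1 hx)).1)
    have hne' : (In' ∪ (↑I.1 : Set (Site d)), (↑I.2 : Set (Site d))) ≠ (In' ∪ ↑I'.1, ↑I'.2) := by
      intro heq
      apply hne
      have h1' : I.1 = I'.1 := by
        have hU : In' ∪ (↑I.1 : Set (Site d)) = In' ∪ ↑I'.1 := congrArg Prod.fst heq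
        ext x
        constructor
        · intro hx
          have : x ∈ In' ∪ (↑I'.1 : Set (Site d)) := by rw [← hU]; exact Or.inr (Finset.mem_coe.2 hx)
          exact this.elim (fun h => absurd h (hsub I hI x hx)) (fun h => Finset.mem_coe.1 h)
        · intro hx
          have : x ∈ In' ∪ (↑I.1 : Set (Site d)) := by rw [hU]; exact Or.inr (Finset.mem_coe.2 hx)
          exact this.elim (fun h => absurd h (hsub I' hI' x hx)) (fun h => Finset.mem_coe.1 h)
      exact Prod.ext h1' (Finset.coe_injective (congrArg Prod.snd heq))
    exact absurd h2.1.1 (Set.disjoint_left.1 (disjoint_explEvent (In := In') (Blk := Blk') hne') h1.1.1)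
  have hsum : ∑ I ∈ 𝒟, μ.real (FIRST I) * μ.real (IDAT I ∩ ILINK I ∩ SECOND I ∩ DAT ∩ LINK) =
      μ.real (⋃ I ∈ 𝒟, (IDAT I ∩ ILINK I ∩ (LEFT ∩ DAT ∩ LINK))) := by
    rw [measureReal_biUnion_finset hdisj hpiece_meas]
    refine Finset.sum_congr rfl fun I hI => ?_
    obtain ⟨hXs, hYs⟩ := hmem𝒟 I hI
    have h := real_kernel_inter_idat_eq_mul p hc hcs hsa hab hH hX hUa hUb hR hRb hXs hYs
    rw [show IDAT I ∩ ILINK I ∩ (LEFT ∩ DAT ∩ LINK) = IDAT I ∩ ILINK I ∩ LEFT ∩ DAT ∩ LINK by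
      simp only [Set.inter_assoc]]
    exact h.symm
  have hset : (⋃ I ∈ 𝒟, (IDAT I ∩ ILINK I ∩ (LEFT ∩ DAT ∩ LINK))) = (⋃ I ∈ 𝒟, (IDAT I ∩ ILINK I)) ∩ (LEFT ∩ DAT ∩ LINK) := by
    ext ω
    simp only [Set.mem_iUnion, Set.mem_inter_iff, exists_prop]
    constructor
    · rintro ⟨I, hI, ⟨hD, hL⟩, hK⟩
      exact ⟨⟨I, hI, hD, hL⟩, hK⟩
    · rintro ⟨⟨I, hI, hD, hL⟩, hK⟩
      exact ⟨I, hI, ⟨hD, hL⟩, hK⟩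
  show ∑ I ∈ 𝒟, μ.real (FIRST I) * μ.real (IDAT I ∩ ILINK I ∩ SECOND I ∩ DAT ∩ LINK) =
    μ.real ((⋃ I ∈ 𝒟, (IDAT I ∩ ILINK I)) ∩ (LEFT ∩ DAT ∩ LINK))
  rw [hsum, hset]

end Summit.CriticalPhenomena.PercolationContinuityZ3.Theorems.Crossing

end
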